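import Literature.NumberTheory.GaloisRepresentations.IdeleClassBarSRelativeLayers
import Literature.NumberTheory.GaloisRepresentations.IdeleTruncatedSLayers
import Literature.NumberTheory.GaloisRepresentations.IdeleTruncation
import Literature.NumberTheory.GaloisRepresentations.IdeleProjectionS
import Literature.Algebra.Homology.DiscreteRepSubgroupLayers
import Literature.Algebra.Homology.DiscreteRepLayerColimitGroupCohomology
import Literature.GroupTheory.ProfiniteSubquotients

/-!
# Relative layers of `Ī_S = I_S`: for a subgroup `W ≤ G_S`, the layers of `(↥W, Res_W I_S)` at the traces `V̄_E ∩ W`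
# (`V̄_E = Gal(K_S/E) ≤ W`) are `(H_E ≤ Gal(E/K), Res_{H_E} J_{E,S})`, and every class of `Extⁿ_{C_W}(ℤ, Res_W I_S)` is
# inflated from some such layer (Harari, *Galois Cohomology and CFT* §17.4 Lemma 17.23; Serre I §2.2 Prop. 8)

Topic `NumberTheory/GaloisRepresentations`; namespace `Literature.NumberTheory.GaloisRepresentations.IdeleClassBar`.  The
`I_S`-analogue of w3 g17's `IdeleClassBarSRelativeLayers.lean` (the `C̄_S` version), whose MODULE-INDEPENDENT §1 is imported and
reused verbatim (`restrictHomS S hE : G_S →* Gal(E/K)`, the image `subgroupImageS S hE W = H_E ≤ Gal(E/K)` of `W`,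
`subgroupImageSEquiv : ↥W ⧸ (V̄_E ∩ W) ≃* H_E`); the module input is -w6's layer formula `I_S^{U_E} = J_{E,S}`
(`IdeleTruncatedSLayers.exists_mem_truncIdeles_of_forall_rep_eq`, `IdeleTruncatedS.of_mem_truncIdeleBar`) and -w6's
`IdeleTruncation.truncRep K E S : Rep ℤ Gal(E/K)` (`J_{E,S}` as a Galois module).  Definitions with bodies (PLUMBING: the
layer injection, the module isomorphism, the induced isomorphism on group cohomology, the relative inflation to the limit)
and theorems; NO named fact, no instance, no notation, no `sorry`; number fields in `Type`.

## What is formalised (`K` a number field, `S : Finset`, `G_S = GaloisGroupUnramifiedOutside K ↑S`, `W : Subgroup G_S`,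
## `E : GalLayer K` with `hE : N_S ≤ Gal(K̄/E)` (`E ⊆ K_S`) and `hEW : V̄_E ≤ W`)

* §1 **`relLayerRepIS S W E := (Res_W I_S)^{V̄_E ∩ W}`** (door-c4's layer object for the group `↥W`, verbatim, so that `stepG`,
  `inflG`, `exists_inflG_eq`, `exists_stepG_eq_zero` apply as they stand), `coe_relLayerRepIS_ρ_mk`.
* §2 **`toLayerIS S hE hEW : J_{E,S} →+ (Res_W I_S)^{V̄_E ∩ W}`** (`x ↦ [x]_E`; `coe_toLayerIS`), `toLayerIS_injective`,
  `toLayerIS_surjective` (the layer formula), `toLayerIS_ρ` (equivariance along `w ↦ w|_E`), **`relLayerISEquiv :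
  ((Res_W I_S)^{V̄_E ∩ W}).V ≃ₗ[ℤ] (Res_{H_E} J_{E,S}).V`**, `relLayerISEquiv_comm`, **`relLayerISCohomologyIso S W hE hEW n :
  Hⁿ(↥W ⧸ (V̄_E ∩ W), (Res_W I_S)^{V̄_E ∩ W}) ≅ Hⁿ(H_E, Res_{H_E} J_{E,S})`** (Mathlib `groupCohomology.mapIso`).
* §3 **`relInflGIS S W hE hEW n : Hⁿ(H_E, Res_{H_E} J_{E,S}) →+ Extⁿ_{C_W}(ℤ, Res_W I_S)`** (door-c4's `inflG` from the trace layer,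
  through §2) and **`exists_relInflGIS_eq`** (`W` open: every class of `Extⁿ_{C_W}(ℤ, Res_W I_S)` is `relInflGIS c` for some layer
  `E ⊆ K_S` with `V̄_E ≤ W` — door-c4 `exists_inflG_eq` for the compact group `↥W`, cofinality
  `DiscreteRep.exists_traceOpenNormalSubgroup_le` + w3 g17 `exists_layerSubgroupS_le`, `inflG_stepG`).

Written for brick E3 / [P2-mono] of lane «PT-Ш-S-TC» (crux `stmt-BirchSwinnertonDyer-19032`, cell bsd-eis; plan
`P2-MONO-SCOPING-w3g18-v2.md` file P2-a, seat bsd-line-x1-p1-w3 gen 18): a class `y ∈ Ext²_{C_U}(ℤ, Res_U I_S)` is read as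
`relInflGIS c`, `c ∈ H²(H_F, J_{F,S})`, and the finite-level analysis of `c` (Tate, C–F VII §7.3) does the rest.  HONEST FRAMING:
layer bookkeeping; no arithmetic statement and no case of BSD is proved here.

## References
* D. Harari, *Galois Cohomology and Class Field Theory*, Universitext (2020), §4.3 (2)–(3), §17.4 (17.1), Lemma 17.23. [Harari2020]
* J.-P. Serre, *Galois Cohomology*, Springer (1997), I §2.2 Proposition 8. [SerreGaloisCohomology1997]
* J. Neukirch, A. Schmidt, K. Wingberg, *Cohomology of Number Fields*, 2nd ed. (2008), VIII §3 (8.3.8). [NeukirchSchmidtWingberg2008]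
-/

noncomputable section

open NumberField IsDedekindDomain CategoryTheory CategoryTheory.Limits groupCohomology
open Field (absoluteGaloisGroup)
open Literature.NumberTheory.Automorphic Literature.NumberTheory.Automorphic.IdeleClassGroup
open Literature.NumberTheory.NumberFields
open Literature.Algebra.Homology
open Literature.NumberTheory.GaloisRepresentations.LocalWeilDatum (galFixing)
open scoped Classical

namespace Literature.NumberTheory.GaloisRepresentations

namespace IdeleClassBar

variable {K : Type} [Field K] [NumberField K] (S : Finset (HeightOneSpectrum (𝓞 K)))
  (W : Subgroup (GaloisGroupUnramifiedOutside K (↑S : Set (HeightOneSpectrum (𝓞 K)))))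

/-! ## §1. The relative layers `(Res_W I_S)^{V̄_E ∩ W}` -/

/-- **Door-c4's layer object for the group `↥W`: `(Res_W I_S)^{V̄_E ∩ W}`** as a representation of `↥W ⧸ (V̄_E ∩ W)`
(`(invariantsQuotFunctor ℤ (V̄_E ∩ W)).obj ((resD ℤ W).obj (truncIdeleBarD K S))`; an abbreviation, so that door-c4's `stepG`,
`inflG`, `exists_inflG_eq` apply verbatim). [cite: SerreGaloisCohomology1997, I §2.2 Proposition 8][cite: Harari2020, §17.4 Lemma 17.23] -/
abbrev relLayerRepIS (E : GalLayer K) :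
    Rep ℤ (W ⧸ (DiscreteRep.traceOpenNormalSubgroup W (layerSubgroupS S E) : Subgroup W)) :=
  (DiscreteRep.invariantsQuotFunctor ℤ (DiscreteRep.traceOpenNormalSubgroup W (layerSubgroupS S E) : Subgroup W)).obj
    ((DiscreteRep.resD ℤ W).obj (truncIdeleBarD K S))

/-- The underlying element of `J̄` of `[w] • z` in the relative layer is `w • z` in `I_S`. [cite: Harari2020, §17.4 (17.1)] -/
theorem coe_relLayerRepIS_ρ_mk (E : GalLayer K) (w : W) (z : (relLayerRepIS S W E).V) :
    Subtype.val (((relLayerRepIS S W E).ρ (QuotientGroup.mk w) z).1) =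
      Subtype.val ((truncIdeleBarRep K S).ρ (w : GaloisGroupUnramifiedOutside K (↑S : Set (HeightOneSpectrum (𝓞 K)))) z.1) :=
  rfl

/-- With `w = [σ]`: the underlying element of `J̄` of `[[σ]] • z` is `σ • z`. [cite: Harari2020, §17.4 (17.1)] -/
theorem coe_relLayerRepIS_ρ_mk_mk (E : GalLayer K) (σ : absoluteGaloisGroup K)
    (hσ : (QuotientGroup.mk σ : GaloisGroupUnramifiedOutside K (↑S : Set (HeightOneSpectrum (𝓞 K)))) ∈ W)
    (z : (relLayerRepIS S W E).V) :
    Subtype.val (((relLayerRepIS S W E).ρ (QuotientGroup.mk ⟨QuotientGroup.mk σ, hσ⟩) z).1) =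
      (ideleData K).toSystem.rep σ (Subtype.val z.1) :=
  rfl

/-! ## §2. The layer formula `(Res_W I_S)^{V̄_E ∩ W} ≅ Res_{H_E} J_{E,S}` and the cohomology of the relative layers -/

section Layer

variable {E : GalLayer K} (hE : ramificationSubgroup K (↑S : Set (HeightOneSpectrum (𝓞 K))) ≤ galFixing K E.1)
  (hEW : (layerSubgroupS S E : Subgroup (GaloisGroupUnramifiedOutside K (↑S : Set (HeightOneSpectrum (𝓞 K))))) ≤ W)

/-- `J_{E,S} ⊆ J_E` on the additive vectors: `Additive J_{E,S} →+ (ideleData K).V E`. [cite: Harari2020, §17.4 (17.1)] -/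
def inclIS (E : GalLayer K) :
    (haveI := E.numberField; Additive (IdeleHerbrand.truncIdeles K E.1 S)) →+ ((ideleData K).toSystem.obj E).V :=
  haveI := E.numberField
  AddMonoidHom.mk'
    (fun x => (Additive.ofMul ((Additive.toMul x : IdeleHerbrand.truncIdeles K E.1 S) : ideleGroup E.1) : (ideleData K).V E))
    fun _ _ => rfl

/-- Formula. [cite: Harari2020, §17.4 (17.1)] -/
theorem toMul_inclIS_apply (x : (haveI := E.numberField; Additive (IdeleHerbrand.truncIdeles K E.1 S))) :
    (haveI := E.numberField; (Additive.toMul (inclIS S E x : (ideleData K).V E) : ideleGroup E.1)) =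
      (haveI := E.numberField; ((Additive.toMul x : IdeleHerbrand.truncIdeles K E.1 S) : ideleGroup E.1)) := rfl

/-- `inclIS` is injective. [cite: Harari2020, §17.4 (17.1)] -/
theorem inclIS_injective : Function.Injective (inclIS S E) := fun x y h => by
  haveI := E.numberField
  have h' := congrArg (fun z : (ideleData K).V E => (Additive.toMul z : ideleGroup E.1)) h
  exact Additive.toMul.injective (Subtype.ext h')

/-- **`x ↦ [x]_E : J_{E,S} →+ J̄`** (the idèle class of a truncated idèle). [cite: Harari2020, §17.4 (17.1)] -/
def ofTruncIdeleHom (E : GalLayer K) :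
    (haveI := E.numberField; Additive (IdeleHerbrand.truncIdeles K E.1 S)) →+ (ideleData K).toSystem.limit :=
  ((ideleData K).toSystem.of E).comp (inclIS S E)

/-- The idèle class `[x]_E ∈ J̄` of a truncated idèle `x ∈ J_{E,S}`. [cite: Harari2020, §17.4 (17.1)] -/
abbrev ofTruncIdele (x : (haveI := E.numberField; Additive (IdeleHerbrand.truncIdeles K E.1 S))) : (ideleData K).toSystem.limit :=
  ofTruncIdeleHom S E x

/-- Formula. [cite: Harari2020, §17.4 (17.1)] -/
theorem ofTruncIdele_eq (x : (haveI := E.numberField; Additive (IdeleHerbrand.truncIdeles K E.1 S))) :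
    ofTruncIdele S x = (ideleData K).toSystem.of E (inclIS S E x) := rfl

include hE in
/-- `[x]_E ∈ I_S` for `E ⊆ K_S`. [cite: Harari2020, §17.4 (17.1)] -/
theorem ofTruncIdele_mem (x : (haveI := E.numberField; Additive (IdeleHerbrand.truncIdeles K E.1 S))) :
    ofTruncIdele S x ∈ truncIdeleBar K S := by
  haveI := E.numberField
  have hE' : ramificationSubgroup K (↑S : Set (HeightOneSpectrum (𝓞 K))) ≤
      (E.openNormalSubgroup : Subgroup (absoluteGaloisGroup K)) := by
    rw [← galFixing_eq_coe_openNormalSubgroup]; exact hE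
  exact of_mem_truncIdeleBar E hE' (x := inclIS S E x) (Additive.toMul x).2

/-- `[x]_E` is fixed by the trace `V̄_E ∩ W` (indeed by `V̄_E`, the image of `Gal(K̄/E)`). [cite: SerreGaloisCohomology1997, I §2.2 Proposition 8] -/
theorem ofTruncIdele_mem_invariants (x : (haveI := E.numberField; Additive (IdeleHerbrand.truncIdeles K E.1 S))) :
    (⟨ofTruncIdele S x, ofTruncIdele_mem S hE x⟩ : ((DiscreteRep.resD ℤ W).obj (truncIdeleBarD K S)).obj.V) ∈
      Representation.invariants ((((DiscreteRep.resD ℤ W).obj (truncIdeleBarD K S)).obj.ρ).comp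
        (DiscreteRep.traceOpenNormalSubgroup W (layerSubgroupS S E) : Subgroup W).subtype) := by
  haveI := E.numberField
  rintro ⟨⟨g, hgW⟩, hg⟩
  obtain ⟨σ, hσ, rfl⟩ := (mem_layerSubgroupS_iff S E g).1 ((DiscreteRep.mem_traceOpenNormalSubgroup_iff W _ _).1 hg)
  refine Subtype.ext ?_
  change (ideleData K).toSystem.rep σ (ofTruncIdele S x) = ofTruncIdele S x
  rw [galFixing_eq_coe_openNormalSubgroup] at hσ
  exact (ideleData K).toSystem.rep_of_of_mem E hσ _

/-- **`x ↦ [x]_E : J_{E,S} →+ (Res_W I_S)^{V̄_E ∩ W}`**. [cite: Harari2020, §17.4 Lemma 17.23] -/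
def toLayerIS : (haveI := E.numberField; Additive (IdeleHerbrand.truncIdeles K E.1 S)) →+ (relLayerRepIS S W E).V :=
  AddMonoidHom.mk' (fun x => ⟨⟨ofTruncIdele S x, ofTruncIdele_mem S hE x⟩, ofTruncIdele_mem_invariants S W hE x⟩) fun x y =>
    Subtype.ext (Subtype.ext (map_add (ofTruncIdeleHom S E) x y))

/-- Formula: the underlying element of `J̄` of `toLayerIS x` is `[x]_E`. [cite: Harari2020, §17.4 Lemma 17.23] -/
@[simp] theorem coe_toLayerIS (x : (haveI := E.numberField; Additive (IdeleHerbrand.truncIdeles K E.1 S))) :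
    Subtype.val (toLayerIS S W hE x).1 = ofTruncIdele S x := rfl

/-- `toLayerIS` is injective (`[·]_E` is). [cite: Harari2020, §17.4 Lemma 17.23] -/
theorem toLayerIS_injective : Function.Injective (toLayerIS S W hE) := fun _ _ hxy =>
  inclIS_injective S ((ideleData K).toSystem.of_injective E (congrArg (fun z => Subtype.val z.1) hxy :))

include hEW in
/-- **The layer formula**: `toLayerIS` is onto — a vector of `(Res_W I_S)^{V̄_E ∩ W}` is fixed by `Gal(K̄/E)` (whose image
`V̄_E` lies in `W`), hence is `[x]_E` with `x ∈ J_{E,S}` (-w6 `exists_mem_truncIdeles_of_forall_rep_eq`).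
[cite: Harari2020, §17.4 Lemma 17.23][cite: CasselsFrohlichANT1967, Ch. VII §8 Prop. 8.1] -/
theorem toLayerIS_surjective : Function.Surjective (toLayerIS S W hE) := fun z => by
  haveI := E.numberField
  have hfix : ∀ σ ∈ E.openNormalSubgroup, (ideleData K).toSystem.rep σ (Subtype.val z.1) = Subtype.val z.1 := by
    intro σ hσ
    have hσ' : σ ∈ galFixing K E.1 := by rw [galFixing_eq_coe_openNormalSubgroup]; exact hσ
    have hmem : (⟨QuotientGroup.mk σ, hEW (mk_mem_layerSubgroupS S E hσ')⟩ : W) ∈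
        (DiscreteRep.traceOpenNormalSubgroup W (layerSubgroupS S E) : Subgroup W) :=
      (DiscreteRep.mem_traceOpenNormalSubgroup_iff W _ _).2 (mk_mem_layerSubgroupS S E hσ')
    exact congrArg Subtype.val (z.2 ⟨_, hmem⟩)
  have hex := exists_mem_truncIdeles_of_forall_rep_eq (S := S) E z.1.2 hfix
  exact ⟨Additive.ofMul ⟨Additive.toMul hex.choose, hex.choose_spec.1⟩, Subtype.ext (Subtype.ext hex.choose_spec.2)⟩

/-- **Equivariance**: `[w] • [x]_E = [w|_E • x]_E` for `w ∈ W`. [cite: Harari2020, §17.4 Lemma 17.23] -/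
theorem toLayerIS_ρ (w : W) (x : (haveI := E.numberField; Additive (IdeleHerbrand.truncIdeles K E.1 S))) :
    (relLayerRepIS S W E).ρ (QuotientGroup.mk w) (toLayerIS S W hE x) =
      toLayerIS S W hE (haveI := E.numberField; (IdeleHerbrand.truncRep K E.1 S).ρ
        (restrictHomS S hE (w : GaloisGroupUnramifiedOutside K (↑S : Set (HeightOneSpectrum (𝓞 K))))) x) := by
  haveI := E.numberField
  obtain ⟨g, hg⟩ := w
  induction g using QuotientGroup.induction_on with
  | H σ =>
    refine Subtype.ext (Subtype.ext ?_)
    change (ideleData K).toSystem.rep σ ((ideleData K).toSystem.of E (inclIS S E x)) =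
      (ideleData K).toSystem.of E (inclIS S E ((IdeleHerbrand.truncRep K E.1 S).ρ
        (restrictHomS S hE (QuotientGroup.mk σ)) x))
    rw [(ideleData K).toSystem.rep_of, restrictHomS_mk]
    rfl

/-- **The relative layer module `(Res_W I_S)^{V̄_E ∩ W} ≃ₗ[ℤ] J_{E,S}`** (inverse of `toLayerIS`); the codomain is written as the
module of `Res_{H_E} J_{E,S}` (the same type), so that Mathlib's `groupCohomology.mapIso` applies verbatim.
[cite: Harari2020, §17.4 Lemma 17.23][cite: NeukirchSchmidtWingberg2008, VIII §3 (8.3.8)] -/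
def relLayerISEquiv :
    letI := (relLayerRepIS S W E).hV2
    letI := (haveI := E.numberField; Rep.res (subgroupImageS S hE W).subtype (IdeleHerbrand.truncRep K E.1 S)).hV2
    (relLayerRepIS S W E).V ≃ₗ[ℤ]
      (haveI := E.numberField; (Rep.res (subgroupImageS S hE W).subtype (IdeleHerbrand.truncRep K E.1 S)).V) :=
  haveI := E.numberField
  (LinearEquiv.ofBijective (toLayerIS S W hE).toIntLinearMap
    ⟨toLayerIS_injective S W hE, toLayerIS_surjective S W hE hEW⟩).symm

/-- Formula: `relLayerISEquiv⁻¹ x = toLayerIS x`. [cite: Harari2020, §17.4 Lemma 17.23] -/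
theorem relLayerISEquiv_symm_apply (x : (haveI := E.numberField; Additive (IdeleHerbrand.truncIdeles K E.1 S))) :
    (relLayerISEquiv S W hE hEW).symm x = toLayerIS S W hE x := rfl

/-- Formula: `relLayerISEquiv (toLayerIS x) = x`. [cite: Harari2020, §17.4 Lemma 17.23] -/
theorem relLayerISEquiv_toLayerIS (x : (haveI := E.numberField; Additive (IdeleHerbrand.truncIdeles K E.1 S))) :
    relLayerISEquiv S W hE hEW (toLayerIS S W hE x) = x :=
  (relLayerISEquiv S W hE hEW).apply_symm_apply x

/-- **`relLayerISEquiv` intertwines the `↥W ⧸ (V̄_E ∩ W)`-action with the `H_E`-action on `J_{E,S}` along `subgroupImageSEquiv`**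
(the form Mathlib's `groupCohomology.mapIso` consumes). [cite: NeukirchSchmidtWingberg2008, VIII §3 (8.3.8)] -/
theorem relLayerISEquiv_comm (g : W ⧸ (DiscreteRep.traceOpenNormalSubgroup W (layerSubgroupS S E) : Subgroup W)) :
    letI := (relLayerRepIS S W E).hV2
    letI := (haveI := E.numberField; Rep.res (subgroupImageS S hE W).subtype (IdeleHerbrand.truncRep K E.1 S)).hV2
    (relLayerISEquiv S W hE hEW).toLinearMap ∘ₗ (relLayerRepIS S W E).ρ g =
      (haveI := E.numberField;
        (Rep.res (subgroupImageS S hE W).subtype (IdeleHerbrand.truncRep K E.1 S)).ρ (subgroupImageSEquiv S hE W g)) ∘ₗ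
        (relLayerISEquiv S W hE hEW).toLinearMap := by
  haveI := E.numberField
  induction g using QuotientGroup.induction_on with
  | H w =>
    -- (explicit `congrArg` chains: `obtain ⟨x, rfl⟩` / `rw` under `relLayerISEquiv` are pathologically slow here)
    refine LinearMap.ext fun z => ?_
    have hz : z = toLayerIS S W hE (relLayerISEquiv S W hE hEW z) :=
      ((relLayerISEquiv S W hE hEW).symm_apply_apply z).symm
    have h1 : (relLayerRepIS S W E).ρ (QuotientGroup.mk w) z =
        toLayerIS S W hE ((IdeleHerbrand.truncRep K E.1 S).ρ
          (restrictHomS S hE (w : GaloisGroupUnramifiedOutside K (↑S : Set (HeightOneSpectrum (𝓞 K)))))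
          (relLayerISEquiv S W hE hEW z)) :=
      (congrArg (fun v => (relLayerRepIS S W E).ρ (QuotientGroup.mk w) v) hz).trans (toLayerIS_ρ S W hE w _)
    change relLayerISEquiv S W hE hEW ((relLayerRepIS S W E).ρ (QuotientGroup.mk w) z) =
      (IdeleHerbrand.truncRep K E.1 S).ρ (restrictHomS S hE (w : GaloisGroupUnramifiedOutside K (↑S : Set (HeightOneSpectrum (𝓞 K)))))
        (relLayerISEquiv S W hE hEW z)
    rw [h1]
    exact relLayerISEquiv_toLayerIS S W hE hEW _

/-- **The relative layers of `I_S` have the cohomology of the subgroups `H_E` with coefficients in `J_{E,S}`: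
`Hⁿ(↥W ⧸ (V̄_E ∩ W), (Res_W I_S)^{V̄_E ∩ W}) ≅ Hⁿ(H_E, Res_{H_E} J_{E,S})`** (Mathlib `groupCohomology.mapIso` along
`subgroupImageSEquiv`, `relLayerISEquiv`).  For `W = V̄_L` (`L ≤ E`) this is `Hⁿ(Gal(E/L), J_{E,S})`, the term of Harari's
`Ext^r_{G_S}(ℤ, I_S) = lim→ H^r(Gal(F/k), J_{F,S})`. [cite: Harari2020, §17.4 Lemma 17.23][cite: SerreGaloisCohomology1997, I §2.2 Proposition 8] -/
def relLayerISCohomologyIso (n : ℕ) :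
    groupCohomology (relLayerRepIS S W E) n ≅
      groupCohomology (haveI := E.numberField;
        Rep.res (subgroupImageS S hE W).subtype (IdeleHerbrand.truncRep K E.1 S)) n :=
  haveI := E.numberField
  groupCohomology.mapIso (subgroupImageSEquiv S hE W) (relLayerISEquiv S W hE hEW) (relLayerISEquiv_comm S W hE hEW) n

end Layer

/-! ## §3. The relative inflation to the limit and the presentation of `Extⁿ_{C_W}(ℤ, Res_W I_S)` by the layers -/

section Presentation

variable {E : GalLayer K} (hE : ramificationSubgroup K (↑S : Set (HeightOneSpectrum (𝓞 K))) ≤ galFixing K E.1)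
  (hEW : (layerSubgroupS S E : Subgroup (GaloisGroupUnramifiedOutside K (↑S : Set (HeightOneSpectrum (𝓞 K))))) ≤ W)

/-- **The relative inflation to the limit**, `relInflGIS S W hE hEW n : Hⁿ(H_E, Res_{H_E} J_{E,S}) →+ Extⁿ_{C_W}(ℤ, Res_W I_S)`:
door-c4's `inflG` from the trace layer `V̄_E ∩ W` of the group `↥W`, precomposed with `(relLayerISCohomologyIso …)⁻¹`.
[cite: SerreGaloisCohomology1997, I §2.2 Proposition 8][cite: Harari2020, §17.4 Lemma 17.23] -/
def relInflGIS (n : ℕ) :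
    groupCohomology (haveI := E.numberField;
        Rep.res (subgroupImageS S hE W).subtype (IdeleHerbrand.truncRep K E.1 S)) n →+
      Abelian.Ext (DiscreteRep.triv (Γ := ↥W) ℤ) ((DiscreteRep.resD ℤ W).obj (truncIdeleBarD K S)) n :=
  (DiscreteRep.LayerColimit.inflG (DiscreteRep.traceOpenNormalSubgroup W (layerSubgroupS S E))
      ((DiscreteRep.resD ℤ W).obj (truncIdeleBarD K S)) n).comp
    (relLayerISCohomologyIso S W hE hEW n).inv.hom.toAddMonoidHom

/-- Formula. [cite: SerreGaloisCohomology1997, I §2.2 Proposition 8] -/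
theorem relInflGIS_apply (n : ℕ)
    (c : groupCohomology (haveI := E.numberField;
      Rep.res (subgroupImageS S hE W).subtype (IdeleHerbrand.truncRep K E.1 S)) n) :
    relInflGIS S W hE hEW n c =
      DiscreteRep.LayerColimit.inflG (DiscreteRep.traceOpenNormalSubgroup W (layerSubgroupS S E))
        ((DiscreteRep.resD ℤ W).obj (truncIdeleBarD K S)) n ((relLayerISCohomologyIso S W hE hEW n).inv c) := rfl

/-- `relInflGIS (iso c₀) = inflG c₀` for a class `c₀` of the relative layer itself. [cite: SerreGaloisCohomology1997, I §2.2 Proposition 8] -/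
theorem relInflGIS_hom (n : ℕ) (c₀ : groupCohomology (relLayerRepIS S W E) n) :
    relInflGIS S W hE hEW n ((relLayerISCohomologyIso S W hE hEW n).hom c₀) =
      DiscreteRep.LayerColimit.inflG (DiscreteRep.traceOpenNormalSubgroup W (layerSubgroupS S E))
        ((DiscreteRep.resD ℤ W).obj (truncIdeleBarD K S)) n c₀ := by
  rw [relInflGIS_apply, CategoryTheory.Iso.hom_inv_id_apply]

end Presentation

/-- **Every class of `Extⁿ_{C_W}(ℤ, Res_W I_S)` (`W ≤ G_S` open) is inflated from some layer `E ⊆ K_S` with `V̄_E ≤ W`**: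
`y = relInflGIS S W hE hEW n c` with `c ∈ Hⁿ(H_E, Res_{H_E} J_{E,S})` — door-c4's `exists_inflG_eq` for the compact group `↥W`,
the cofinality of the traces of the layer subgroups (`DiscreteRep.exists_traceOpenNormalSubgroup_le`, `exists_layerSubgroupS_le`)
and `inflG_stepG`. [cite: SerreGaloisCohomology1997, I §2.2 Proposition 8][cite: Harari2020, §17.4 Lemma 17.23] -/
theorem exists_relInflGIS_eq
    (hW : IsOpen (W : Set (GaloisGroupUnramifiedOutside K (↑S : Set (HeightOneSpectrum (𝓞 K)))))) (n : ℕ)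
    (y : Abelian.Ext (DiscreteRep.triv (Γ := ↥W) ℤ) ((DiscreteRep.resD ℤ W).obj (truncIdeleBarD K S)) n) :
    ∃ (E : GalLayer K) (hE : ramificationSubgroup K (↑S : Set (HeightOneSpectrum (𝓞 K))) ≤ galFixing K E.1)
      (hEW : (layerSubgroupS S E : Subgroup (GaloisGroupUnramifiedOutside K (↑S : Set (HeightOneSpectrum (𝓞 K))))) ≤ W)
      (c : groupCohomology (haveI := E.numberField;
        Rep.res (subgroupImageS S hE W).subtype (IdeleHerbrand.truncRep K E.1 S)) n),
      relInflGIS S W hE hEW n c = y := by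
  haveI := DiscreteRep.LayerColimit.compactSpace_subgroup_of_isOpen W hW
  haveI : TotallyDisconnectedSpace (GaloisGroupUnramifiedOutside K (↑S : Set (HeightOneSpectrum (𝓞 K)))) :=
    Literature.GroupTheory.ProfiniteSubquotients.totallyDisconnectedSpace_quotient
      (ramificationSubgroup K (↑S : Set (HeightOneSpectrum (𝓞 K)))) (ramificationSubgroup_isClosed K _)
  obtain ⟨U₀, c₀, rfl⟩ := DiscreteRep.LayerColimit.exists_inflG_eq n ((DiscreteRep.resD ℤ W).obj (truncIdeleBarD K S)) y
  obtain ⟨V, hVW, hVU₀⟩ := DiscreteRep.exists_traceOpenNormalSubgroup_le W hW U₀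
  obtain ⟨E, hE, hEV⟩ := exists_layerSubgroupS_le S V
  have hEW : (layerSubgroupS S E : Subgroup (GaloisGroupUnramifiedOutside K (↑S : Set (HeightOneSpectrum (𝓞 K))))) ≤ W :=
    hEV.trans hVW
  have htr : (DiscreteRep.traceOpenNormalSubgroup W (layerSubgroupS S E) : Subgroup W) ≤ U₀ :=
    (DiscreteRep.traceOpenNormalSubgroup_mono W hEV).trans hVU₀
  refine ⟨E, hE, hEW, (relLayerISCohomologyIso S W hE hEW n).hom
    (DiscreteRep.LayerColimit.stepG U₀ (DiscreteRep.traceOpenNormalSubgroup W (layerSubgroupS S E)) htr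
      ((DiscreteRep.resD ℤ W).obj (truncIdeleBarD K S)) n c₀), ?_⟩
  rw [relInflGIS_hom, DiscreteRep.LayerColimit.inflG_stepG]

end IdeleClassBar

end Literature.NumberTheory.GaloisRepresentations

end
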